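import Summits.QuantumFields.YangMills.Theorems.BalabanUVNodesN15KingModelBoxSumRulesResolvent
import Summits.QuantumFields.YangMills.Theorems.BalabanUVNodesN15KingModelBoxGreenDiagonal
import HarnessLib

/-!
# BalabanUVNodes ∕ N15 — THE KING-MODEL RUNG (PART Ϟ-x): THE ULTRALOCAL (LARGE-MASS) LIMIT `m² → ∞` AT FIXED `c ≥ 0` — `m²·G_T(x,y) → δ_{xy}`, `m²·G^Ω(s,t) → δ_{st}`,
# `m²·K_∞(z) → δ_{z0}`, and `f − ln m² → 0` for the periodic, free-boundary and infinite-volume free energy densities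
# (Track A, DAG node N15 = NE2; FAN-OUT v1.1 §N15 s3 «KING-MODEL RUNG»; King (2.17) p.653, (3.89) p.668, (4.4) p.670, §4 p.670 l.8–13; count-neutral)

HONEST FRAMING.  Count-neutral (cell `pub-ymgap`, seat `pub-ymgap-dag-n15-e` g41; K3ᴬ key **stmt-QuantumFields-27247** `--supports … --as helper` per KEY MAP v3).  TEMPLATE LITERATURE:
C. King, Commun. Math. Phys. **102** (1986) 649–677 [King1986]: (2.13)∕(2.17) p.653, (3.89) p.668, (4.4) p.670, (4.35) p.674, §4 p.670 l.8–13; T. Bałaban, Commun. Math. Phys. **89** (1983)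
571–597 [Balaban1983RegularityDecay]: (2.43) p.584.  By part Ϟ-w's change of units the regime `m² → ∞` at fixed `c` is the regime `c∕m² → 0` at unit mass: the covariances become
ultralocal and the free energy densities approach `ln m²`.  THIS FILE makes the four limits explicit: §0 `tendsto_log_add_sub_log` (`ln(m+a) − ln m → 0`), `tendsto_mul_inv_add`
(`m(m+a)⁻¹ → 1`); §1 TORUS `sum_chi_momentum` (`Σ_q e^{iq·x} = |T|δ_{x,0}`, the momentum-side orthogonality), ★★★ **`tendsto_mass_mul_lapF_inv`** (`m²G_T(x,y) → δ_{xy}`: Ε-e's plane-wave formula term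
by term), ★★ **`tendsto_log_det_lapF_div_card_sub_log`** (`f_T(c,m²) − ln m² → 0`: Ε-k's two-sided bounds); §2 INFINITE VOLUME ★★ **`tendsto_kingFreeEnergyInf_sub_log`** (`f_∞ − ln m² → 0`, Ε-m's
bounds), ★★ **`tendsto_mass_mul_freeKer_zero`** (`m²K_∞(0) → 1`, Ε-f's bounds), ★ `freeKer_add_freeKer_zero_le` (`K_∞(z) + K_∞(0) ≤ 1∕m²` for `z ≠ 0`, from Ε-b's total mass), ★★
**`tendsto_mass_mul_freeKer_of_ne_zero`** (`m²K_∞(z) → 0`, `z ≠ 0`); §3 BOX ★★★ **`tendsto_mass_mul_kingBoxGreen`** (`m²G^Ω(s,t) → δ_{st}`: the direct image tends to `δ_{st}`, every reflected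
image to `0` since `σ_S(t̃) ≠ s̃` for `S ≠ ∅`, Ν's `dblBox_ne_torReflS`), ★★ **`tendsto_log_det_boxOp_div_card_sub_log`** (`f_Ω − ln m² → 0`, Ϟ-c's bounds).

PRIOR TREE ART (named, USED not restated): Ε-e (`lapF_inv_apply_eq_fourier`), Ε-k (`log_det_lapF_bounds`), Ϟ-c (`log_det_boxOp_bounds`), Ϟ-s (`lapSym_eq_add_mass`), Ε-m (`kingFreeEnergyInf_bounds`),
Ε-f (`inv_le_freeKer_zero`, `freeKer_zero_le_inv_mass`, `freeKer_nonneg`), Ε-b (`tsum_freeKer_eq_inv_mass`, `summable_freeKer`), Ν (`kingBoxGreen`, `dblBox_injective`, `dblBox_ne_torReflS`,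
`torReflS_empty`), `King1986` (`lapF`, `lapSym`, `lapSym_ge`), `B5Prop11Plancherel` (`Tor`, `chi`, `sum_chi`).  NOT Bałaban's covariant objects; NOT a node discharge (N15 is booked through
n15-a's knit, untouched); nothing continuum-YM ∕ `ℝ⁴` ∕ OS ∕ Clay.  0 `sorry`; 0 `def`.

HONEST SCOPE.  King's `A = 0` free symbol ∕ operators at FIXED `c ≥ 0` as `m² → ∞` (limits along `Filter.atTop` in the real variable `m²`; no rate is claimed beyond the displayed two-sided
bounds).  Locators: [King1986] (2.13)∕(2.17) p.653, (3.89) p.668, (4.4) p.670, (4.35) p.674, §4 p.670 l.8–13; [Balaban1983RegularityDecay] (2.43) p.584.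
-/

noncomputable section

open scoped BigOperators Topology
open Finset Filter

namespace Summit.QuantumFields.YangMills.BalabanUVNodes.N15KingModelRung.TorusSpectral

open Literature.MathematicalPhysics.QuantumFieldTheory.Balaban1983to89.B5Prop11Plancherel (Tor chi sum_chi)
open Literature.MathematicalPhysics.QuantumFieldTheory.King1986.Torus

variable {d : ℕ}

/-! ## §0 Two elementary limits -/

/-- `ln(m + a) − ln m → 0` as `m → ∞` (`a ≥ 0`). [folklore] -/
theorem tendsto_log_add_sub_log {a : ℝ} (ha : 0 ≤ a) : Tendsto (fun m : ℝ => Real.log (m + a) - Real.log m) atTop (𝓝 0) := by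
  have h1 : Tendsto (fun m : ℝ => a * m⁻¹) atTop (𝓝 0) := by simpa using tendsto_inv_atTop_zero.const_mul a
  have h2 : Tendsto (fun m : ℝ => Real.log (1 + a * m⁻¹)) atTop (𝓝 0) := by
    have h := (Real.continuousAt_log (by norm_num : (1 : ℝ) + 0 ≠ 0)).tendsto.comp (tendsto_const_nhds.add h1)
    simpa [Function.comp_def] using h
  refine h2.congr' ?_
  filter_upwards [eventually_gt_atTop 0] with m hm
  rw [← Real.log_div (by positivity) hm.ne', add_div, div_self hm.ne', div_eq_mul_inv]

/-- `m·(m + a)⁻¹ → 1` as `m → ∞` (`a ≥ 0`). [folklore] -/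
theorem tendsto_mul_inv_add {a : ℝ} (ha : 0 ≤ a) : Tendsto (fun m : ℝ => m * (m + a)⁻¹) atTop (𝓝 1) := by
  have h1 : Tendsto (fun m : ℝ => (m + a)⁻¹) atTop (𝓝 0) := tendsto_inv_atTop_zero.comp (tendsto_atTop_add_const_right _ _ tendsto_id)
  have h2 : Tendsto (fun m : ℝ => 1 - a * (m + a)⁻¹) atTop (𝓝 (1 - a * 0)) := tendsto_const_nhds.sub (h1.const_mul _)
  rw [mul_zero, sub_zero] at h2
  refine h2.congr' ?_
  filter_upwards [eventually_gt_atTop 0] with m hm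
  have hpos : m + a ≠ 0 := by positivity
  field_simp
  ring

/-! ## §1 The torus -/

section Torus

variable (K : Fin (d + 1) → ℕ) [hK : ∀ i, NeZero (K i)] {c : ℝ}

/-- momentum-side orthogonality: `Σ_q e^{iq·x} = |T|·δ_{x,0}` (the characters are symmetric in `(q, x)`). [folklore] -/
theorem sum_chi_momentum (x : Tor K) : ∑ q : Tor K, chi K q x = if x = 0 then (Fintype.card (Tor K) : ℂ) else 0 := by
  have h : ∀ q : Tor K, chi K q x = chi K x q := fun q => by
    unfold chi
    exact Finset.prod_congr rfl fun μ _ => by rw [mul_comm]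
  simp_rw [h]
  exact sum_chi K x

/-- ★★★ **THE TORUS COVARIANCE IS ULTRALOCAL AT LARGE MASS**: `m²·G_T(x,y) → δ_{xy}` as `m² → ∞` at fixed `c ≥ 0`. [cite: King1986, (2.17) p.653, (4.4) p.670, (4.35) p.674] -/
theorem tendsto_mass_mul_lapF_inv (hc : 0 ≤ c) (x y : Tor K) :
    Tendsto (fun m2 : ℝ => m2 * (lapF K c m2)⁻¹ x y) atTop (𝓝 (if x = y then 1 else 0)) := by
  have hcard : (0 : ℝ) < Fintype.card (Tor K) := by exact_mod_cast Fintype.card_pos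
  have hterm : ∀ q : Tor K, Tendsto (fun m : ℝ => m * (m + lapSym K c 0 q)⁻¹ * (chi K q (x - y)).re) atTop (𝓝 (1 * (chi K q (x - y)).re)) :=
    fun q => (tendsto_mul_inv_add (lapSym_ge K c 0 hc q)).mul_const _
  have hsum := (tendsto_finsetSum Finset.univ fun q _ => hterm q).const_mul ((Fintype.card (Tor K) : ℝ)⁻¹)
  have hval : (Fintype.card (Tor K) : ℝ)⁻¹ * ∑ q : Tor K, 1 * (chi K q (x - y)).re = if x = y then 1 else 0 := by
    simp_rw [one_mul]
    rw [← Complex.re_sum, sum_chi_momentum K (x - y)]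
    by_cases h : x = y
    · subst h
      rw [sub_self, if_pos rfl, if_pos rfl, Complex.natCast_re, inv_mul_cancel₀ hcard.ne']
    · have h' : x - y ≠ 0 := sub_ne_zero.mpr h
      rw [if_neg h', if_neg h, Complex.zero_re, mul_zero]
  rw [hval] at hsum
  refine hsum.congr' ?_
  filter_upwards [eventually_gt_atTop 0] with m hm
  conv_rhs => rw [lapF_inv_apply_eq_fourier K hc hm x y, mul_left_comm, Finset.mul_sum]
  congr 1
  refine Finset.sum_congr rfl fun q _ => ?_
  rw [lapSym_eq_add_mass K c m q]
  ring

/-- ★★ **THE PERIODIC FREE ENERGY DENSITY IS `ln m² + o(1)`**: `|T|⁻¹ln det(c(−Δ)+m²) − ln m² → 0` as `m² → ∞` (between `0` and `ln(1 + 4c(d+1)∕m²)`). [cite: King1986, (3.89) p.668, (4.4) p.670] -/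
theorem tendsto_log_det_lapF_div_card_sub_log (hc : 0 ≤ c) :
    Tendsto (fun m2 : ℝ => (Fintype.card (Tor K) : ℝ)⁻¹ * Real.log (lapF K c m2).det - Real.log m2) atTop (𝓝 0) := by
  have hcard : (0 : ℝ) < Fintype.card (Tor K) := by exact_mod_cast Fintype.card_pos
  refine tendsto_of_tendsto_of_tendsto_of_le_of_le' tendsto_const_nhds (tendsto_log_add_sub_log (a := 4 * c * (d + 1)) (by positivity)) ?_ ?_
  · filter_upwards [eventually_gt_atTop 0] with m hm
    have h := (log_det_lapF_bounds K hc hm).1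
    rw [sub_nonneg, le_inv_mul_iff₀ hcard]
    linarith
  · filter_upwards [eventually_gt_atTop 0] with m hm
    have h := (log_det_lapF_bounds K hc hm).2
    rw [sub_le_sub_iff_right, inv_mul_le_iff₀ hcard]
    linarith

end Torus

/-! ## §2 Infinite volume -/

section Infinite

variable {c : ℝ}

/-- ★★ **`f_∞(c,m²) − ln m² → 0`** as `m² → ∞` (between `0` and `ln(1 + 4c(d+1)∕m²)`, part Ε-m). [cite: King1986, (3.89) p.668, (4.4) p.670] -/
theorem tendsto_kingFreeEnergyInf_sub_log (hc : 0 ≤ c) : Tendsto (fun m2 : ℝ => kingFreeEnergyInf c m2 d - Real.log m2) atTop (𝓝 0) := by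
  refine tendsto_of_tendsto_of_tendsto_of_le_of_le' tendsto_const_nhds (tendsto_log_add_sub_log (a := 4 * c * (d + 1)) (by positivity)) ?_ ?_
  · filter_upwards [eventually_gt_atTop 0] with m hm
    linarith [(kingFreeEnergyInf_bounds (d := d) hc hm).1]
  · filter_upwards [eventually_gt_atTop 0] with m hm
    linarith [(kingFreeEnergyInf_bounds (d := d) hc hm).2]

/-- ★★ **`m²·K_∞(0) → 1`** as `m² → ∞` (between `m²∕(m²+4c(d+1))` and `1`, part Ε-f). [cite: Balaban1983RegularityDecay, (2.43) p.584; King1986, (4.4) p.670] -/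
theorem tendsto_mass_mul_freeKer_zero (hc : 0 ≤ c) : Tendsto (fun m2 : ℝ => m2 * freeKer c m2 (0 : Fin (d + 1) → ℤ)) atTop (𝓝 1) := by
  refine tendsto_of_tendsto_of_tendsto_of_le_of_le' (tendsto_mul_inv_add (a := 4 * c * (d + 1)) (by positivity)) tendsto_const_nhds ?_ ?_
  · filter_upwards [eventually_gt_atTop 0] with m hm
    exact mul_le_mul_of_nonneg_left (inv_le_freeKer_zero hc hm) hm.le
  · filter_upwards [eventually_gt_atTop 0] with m hm
    have h := mul_le_mul_of_nonneg_left (freeKer_zero_le_inv_mass (d := d) hc hm) hm.le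
    rwa [mul_inv_cancel₀ hm.ne'] at h

/-- ★ `K_∞(z) + K_∞(0) ≤ 1∕m²` for `z ≠ 0` (two distinct non-negative terms of the total mass `Σ_wK_∞(w) = 1∕m²`, part Ε-b). [cite: Balaban1983RegularityDecay, (2.43) p.584; King1986, (4.4) p.670] -/
theorem freeKer_add_freeKer_zero_le (hc : 0 ≤ c) {m2 : ℝ} (hm : 0 < m2) {z : Fin (d + 1) → ℤ} (hz : z ≠ 0) :
    freeKer c m2 z + freeKer c m2 (0 : Fin (d + 1) → ℤ) ≤ m2⁻¹ := by
  rw [← tsum_freeKer_eq_inv_mass (d := d) hc hm]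
  have h := (summable_freeKer (d := d) hc hm).sum_le_tsum {z, 0} fun w _ => freeKer_nonneg hc hm w
  rwa [Finset.sum_pair hz] at h

/-- ★★ **`m²·K_∞(z) → 0` FOR `z ≠ 0`** as `m² → ∞` (`0 ≤ m²K_∞(z) ≤ 1 − m²K_∞(0) → 0`). [cite: Balaban1983RegularityDecay, (2.43) p.584; King1986, (4.4) p.670] -/
theorem tendsto_mass_mul_freeKer_of_ne_zero (hc : 0 ≤ c) {z : Fin (d + 1) → ℤ} (hz : z ≠ 0) :
    Tendsto (fun m2 : ℝ => m2 * freeKer c m2 z) atTop (𝓝 0) := by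
  have h1 : Tendsto (fun m2 : ℝ => 1 - m2 * freeKer c m2 (0 : Fin (d + 1) → ℤ)) atTop (𝓝 (1 - 1)) := tendsto_const_nhds.sub (tendsto_mass_mul_freeKer_zero hc)
  rw [sub_self] at h1
  refine tendsto_of_tendsto_of_tendsto_of_le_of_le' tendsto_const_nhds h1 ?_ ?_
  · filter_upwards [eventually_gt_atTop 0] with m hm
    exact mul_nonneg hm.le (freeKer_nonneg hc hm z)
  · filter_upwards [eventually_gt_atTop 0] with m hm
    have h := mul_le_mul_of_nonneg_left (freeKer_add_freeKer_zero_le (d := d) hc hm hz) hm.le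
    rw [mul_add, mul_inv_cancel₀ hm.ne'] at h
    linarith

/-- ★★ in one statement: `m²·K_∞(z) → δ_{z,0}`. [cite: Balaban1983RegularityDecay, (2.43) p.584; King1986, (4.4) p.670] -/
theorem tendsto_mass_mul_freeKer (hc : 0 ≤ c) (z : Fin (d + 1) → ℤ) :
    Tendsto (fun m2 : ℝ => m2 * freeKer c m2 z) atTop (𝓝 (if z = 0 then 1 else 0)) := by
  by_cases hz : z = 0
  · rw [if_pos hz, hz]; exact tendsto_mass_mul_freeKer_zero hc
  · rw [if_neg hz]; exact tendsto_mass_mul_freeKer_of_ne_zero hc hz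

end Infinite

/-! ## §3 The box with free boundary conditions -/

section Box

variable (n : Fin (d + 1) → ℕ) [hn : ∀ μ, NeZero (n μ)] {c : ℝ}

/-- ★★★ **THE NEUMANN GREEN's FUNCTION IS ULTRALOCAL AT LARGE MASS**: `m²·G^Ω(s,t) → δ_{st}` as `m² → ∞` at fixed `c ≥ 0` (the direct image tends to `δ_{st}`, every reflected image to
`0`). [cite: King1986, (2.17) p.653, §4 p.670 l.8–13] -/
theorem tendsto_mass_mul_kingBoxGreen (hc : 0 ≤ c) (s t : KingBox n) :
    Tendsto (fun m2 : ℝ => m2 * kingBoxGreen n c m2 s t) atTop (𝓝 (if s = t then 1 else 0)) := by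
  have himg : ∀ S : Finset (Fin (d + 1)), Tendsto (fun m2 : ℝ => m2 * (lapF (dblPer n) c m2)⁻¹ (dblBox n s) (torReflS (dblPer n) S (dblBox n t))) atTop
      (𝓝 (if dblBox n s = torReflS (dblPer n) S (dblBox n t) then 1 else 0)) := fun S => tendsto_mass_mul_lapF_inv (dblPer n) hc _ _
  have hsum := tendsto_finsetSum Finset.univ fun S _ => himg S
  have hval : ∑ S : Finset (Fin (d + 1)), (if dblBox n s = torReflS (dblPer n) S (dblBox n t) then (1 : ℝ) else 0) = if s = t then 1 else 0 := by
    rw [Finset.sum_eq_single ∅ (fun S _ hS => if_neg (dblBox_ne_torReflS n (Finset.nonempty_iff_ne_empty.mpr hS) s t)) (fun h => absurd (Finset.mem_univ ∅) h), torReflS_empty]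
    by_cases h : s = t
    · rw [if_pos h, if_pos (congrArg (dblBox n) h)]
    · rw [if_neg h, if_neg (fun h' => h (dblBox_injective n h'))]
  rw [hval] at hsum
  refine hsum.congr fun m2 => ?_
  unfold kingBoxGreen
  rw [Finset.mul_sum]

/-- ★★ **THE FREE-BOUNDARY FREE ENERGY DENSITY IS `ln m² + o(1)`**: `|Ω|⁻¹ln det(c(−Δ_free)+m²)_Ω − ln m² → 0` as `m² → ∞`. [cite: King1986, (3.89) p.668, §4 p.670 l.8–13] -/
theorem tendsto_log_det_boxOp_div_card_sub_log (hc : 0 ≤ c) :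
    Tendsto (fun m2 : ℝ => (Fintype.card (KingBox n) : ℝ)⁻¹ * Real.log (boxOp n c m2).det - Real.log m2) atTop (𝓝 0) := by
  have hcard : (0 : ℝ) < Fintype.card (KingBox n) := by exact_mod_cast Fintype.card_pos
  refine tendsto_of_tendsto_of_tendsto_of_le_of_le' tendsto_const_nhds (tendsto_log_add_sub_log (a := 4 * c * (d + 1)) (by positivity)) ?_ ?_
  · filter_upwards [eventually_gt_atTop 0] with m hm
    have h := (log_det_boxOp_bounds n hc hm).1
    rw [sub_nonneg, le_inv_mul_iff₀ hcard]
    linarith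
  · filter_upwards [eventually_gt_atTop 0] with m hm
    have h := (log_det_boxOp_bounds n hc hm).2
    rw [sub_le_sub_iff_right, inv_mul_le_iff₀ hcard]
    linarith

end Box

end Summit.QuantumFields.YangMills.BalabanUVNodes.N15KingModelRung.TorusSpectral

end
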